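import Mathlib
import Summits.KontsevichZagierPeriods.Zeta5Search.TwoTaleOmega.FormalBarnesLink
import Summits.KontsevichZagierPeriods.Zeta5Search.TwoTaleOmega.FormalBarnesTLink
import Summits.KontsevichZagierPeriods.Zeta5Search.TwoTaleOmega.FormalBarnesUnique
import Summits.KontsevichZagierPeriods.Zeta5Search.TwoTaleP15FirstTale
import Summits.KontsevichZagierPeriods.Zeta5Search.TwoTaleP15SecondTale

/-!
# (bmiss) on the parameter family `p = (a,b,e,f,g)`: the two data and the sign-free functional form

HONEST FRAMING: systematic search; no irrationality claim unless certified. Pure algebra over `ℚ`; no named fact, no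
`sorry`. Blueprint `families/tele/RECURRENCE.md` §13 (F9/F12 hinge).

Zudilin's missing two-tale identity (bmiss) [Zudilin2014ZetaTwo, p. 8] is indexed by `p = (a,b,e,f,g) ∈ ℤ⁵` through the
parameter maps (FAMILY.md §2.5 of the cell)
* tale 1: `a(p) = (e, f, b, a)`, `b(p) = (1, a−e+1, a−f+1, g)`;
* tale 2: `â(p) = (g−b+a; f, e, a)`, `b̂(p) = (a+1; a−b+1, e+f, g)`;
and reads `formQ a(p) b(p) = −formQT â(p) b̂(p)`, `formP a(p) b(p) = −formPT â(p) b̂(p)` (`Bmiss p`). The point P15 of the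
cell is `p = P15 n = (15n+1, 9n+1, 13n+1, 11n+1, 26n+2)` (`P15_t1a` … `P15_t2b` check this against `aP15, bP15, aT, bT`),
so `∀ n ≥ 1, Bmiss (P15 n)` gives the hypothesis `hP` of `TwoTaleP15Endgame` (`hP_of_Bmiss`).

This file fixes, once, the NORMALISATIONS and SIGNS between the forms and the formal Barnes functionals:
* the data `vL p := data R(a(p),b(p)) · Π(p)⁻¹` and `vR p := data R̂(â(p),b̂(p)) · ε_p Π(p)⁻¹` (`ε_p = (−1)^{a+b+e+f}`,
  `Π(p) = FirstTale.Pi a(p) b(p) = (g−a−1)!/((e−1)!(f−a+e−1)!(b−a+f−1)!)`), whose values are the two Barnes integrands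
  `F_L(p;t) = num/den` and `F_R(p;t) = ε_p R̂/Π` of the telescoping certificates (`vL_eval`, `vR_eval`) — these are the data
  on which the certificates' recurrences act with the SAME telescoper `c_k(p)` on both sides;
* the key sign identity `(−1)^{d(p)} · signT b̂(p) · ε_p = −1` (`sign_key`; `d + (e+f+g) + (a+b+e+f)` is odd);
* hence `formQ + formQT = (−1)^d Π · U1 p` and `formP + formPT = −(−1)^d Π · U0 p` with the p-INDEPENDENT combinations
  `U1 p = Λ¹[vL p] + E¹[vR p]/4`, `U0 p = Λ⁰[vL p] + E⁰[vR p]/2` (`formQ_add_formQT`, `formP_add_formPT`), and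
  `Bmiss p ↔ U1 p = 0 ∧ U0 p = 0` (`bmiss_iff`). Since the recurrences are linear with common coefficients, `U1, U0`
  satisfy them too, and the closure induction of RECURRENCE.md §12 runs on `(U1, U0)` with no sign bookkeeping left.
-/

open Finset
open Literature.NumberTheory.Irrationality.Zudilin2014
open Summit.KontsevichZagierPeriods.Zeta5Search.FormalBarnes

noncomputable section -- lane edit (lead/lit g13): the PF data combinators are noncomputable in the landed FormalBarnes* files

namespace Summit.KontsevichZagierPeriods.Zeta5Search.TwoTaleOmega

/-- A parameter point `p = (a,b,e,f,g) ∈ ℤ⁵` of the (bmiss) family. -/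
structure Pt where
  /-- `a` -/
  a : ℤ
  /-- `b` -/
  b : ℤ
  /-- `e` -/
  e : ℤ
  /-- `f` -/
  f : ℤ
  /-- `g` -/
  g : ℤ

namespace Pt

variable (p : Pt)

/-- Tale-1 numerator parameters `a(p) = (e, f, b, a)`. -/
def t1a : Fin 4 → ℤ := ![p.e, p.f, p.b, p.a]

/-- Tale-1 denominator parameters `b(p) = (1, a−e+1, a−f+1, g)`. -/
def t1b : Fin 4 → ℤ := ![1, p.a - p.e + 1, p.a - p.f + 1, p.g]

/-- Tale-2 numerator parameters `â(p) = (g−b+a; f, e, a)`. -/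
def t2a : Fin 4 → ℤ := ![p.g - p.b + p.a, p.f, p.e, p.a]

/-- Tale-2 denominator parameters `b̂(p) = (a+1; a−b+1, e+f, g)`. -/
def t2b : Fin 4 → ℤ := ![p.a + 1, p.a - p.b + 1, p.e + p.f, p.g]

/-- The sign `ε_p = (−1)^{a+b+e+f}` of the right-hand side of (bmiss). -/
def eps : ℚ := (-1) ^ (p.a + p.b + p.e + p.f).natAbs

/-- The common normalising constant `Π(p) = (g−a−1)!/((e−1)!(f−a+e−1)!(b−a+f−1)!)` (= `FirstTale.Pi a(p) b(p)`). -/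
def Pi : ℚ := Literature.NumberTheory.Irrationality.Zudilin2014.Pi p.t1a p.t1b

/-- The balance `d(p) = Σ a(p) − Σ b(p) = 2e + 2f + b − a − g − 3`. -/
def dInt : ℤ := 2 * p.e + 2 * p.f + p.b - p.a - p.g - 3

/-- The tale-1 node `1 − a₂*(a(p))`. -/
def nodeL : ℤ := 1 - a2star p.t1a

/-- The tale-2 node `1 − â₀*(â(p))` (in the variable `u = 2t`). -/
def nodeR : ℤ := 1 - a0star p.t2a

/-- The tale-1 data `vL p = data R(a(p),b(p);·) · Π(p)⁻¹`, value `F_L(p;t) = num(t)/den(t)`. -/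
def vL : PF := (dataR p.t1a p.t1b).smul (p.Pi)⁻¹

/-- The tale-2 data `vR p = data R̂(â(p),b̂(p);u/2) · ε_p Π(p)⁻¹`, value `F_R(p;u/2)`. -/
def vR : PF := (dataRT p.t2a p.t2b).smul (p.eps * (p.Pi)⁻¹)

/-- (bmiss) at the point `p`: both coordinates. -/
def Bmiss : Prop :=
  formQ p.t1a p.t1b = -formQT p.t2a p.t2b ∧ formP p.t1a p.t1b = -formPT p.t2a p.t2b

/-- The `ζ(2)`-coordinate combination `U1 p = Λ¹_{nodeL}[vL p] + E¹_{nodeR}[vR p]/4`. -/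
def U1 : ℚ := lam1 p.nodeL p.vL + altE1 p.nodeR p.vR / 4

/-- The rational-coordinate combination `U0 p = Λ⁰_{nodeL}[vL p] + E⁰_{nodeR}[vR p]/2`. -/
def U0 : ℚ := lam0 (dExp p.t1a p.t1b) p.nodeL p.vL + altE0 0 p.nodeR p.vR / 2

/-! ### Bookkeeping lemmas -/

/-- `Σ a(p) = e + f + b + a`. -/
theorem sum_t1a : ∑ i, p.t1a i = p.e + (p.f + (p.b + p.a)) := by
  simp [t1a, Fin.sum_univ_four, add_assoc]

/-- `Σ b(p) = 1 + (a−e+1) + (a−f+1) + g`. -/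
theorem sum_t1b : ∑ i, p.t1b i = 1 + (p.a - p.e + 1 + (p.a - p.f + 1 + p.g)) := by
  simp [t1b, Fin.sum_univ_four, add_assoc]

/-- `Σ a(p) − Σ b(p) = d(p)`. -/
theorem sum_t1a_sub_sum_t1b : ∑ i, p.t1a i - ∑ i, p.t1b i = p.dInt := by
  rw [sum_t1a, sum_t1b]; unfold dInt; ring

/-- Under the balance condition `d(p) ≥ 0`, `dExp a(p) b(p) = d(p)` as integers. -/
theorem dExp_eq (hd : 0 ≤ p.dInt) : (dExp p.t1a p.t1b : ℤ) = p.dInt := by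
  unfold dExp; rw [sum_t1a_sub_sum_t1b, Int.toNat_of_nonneg hd]

/-- `b̂₂ + b̂₃ = e + f + g`. -/
theorem t2b_two_add_three : p.t2b 2 + p.t2b 3 = p.e + p.f + p.g := by
  simp [t2b]

/-- `Π(p) ≠ 0`. -/
theorem Pi_ne_zero : p.Pi ≠ 0 := Literature.NumberTheory.Irrationality.Zudilin2014.Pi_ne_zero _ _

/-- `ε_p² = 1`. -/
theorem eps_mul_eps : p.eps * p.eps = 1 := by
  unfold eps; rw [← pow_add, ← two_mul, pow_mul]; norm_num

/-- `(−1)^{|n|} = (−1)^n` in `ℚ`. -/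
theorem neg_one_pow_natAbs (n : ℤ) : ((-1 : ℚ)) ^ n.natAbs = (-1 : ℚ) ^ n := by
  rcases Int.natAbs_eq n with h | h
  · conv_rhs => rw [h]
    exact (zpow_natCast _ _).symm
  · conv_rhs => rw [h]
    rw [zpow_neg, zpow_natCast, ← inv_pow, inv_neg_one]

/-- **Key sign identity**: `(−1)^{d(p)} · signT b̂(p) · ε_p = −1` (for `d(p) ≥ 0`), because
`d + (e+f+g) + (a+b+e+f) = 2(2e + 2f + b − 2) + 1` is odd. -/
theorem sign_key (hd : 0 ≤ p.dInt) : (-1 : ℚ) ^ dExp p.t1a p.t1b * signT p.t2b * p.eps = -1 := by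
  have h1 : ((-1 : ℚ)) ^ dExp p.t1a p.t1b = (-1 : ℚ) ^ p.dInt := by
    rw [← zpow_natCast, dExp_eq p hd]
  have h2 : signT p.t2b = (-1 : ℚ) ^ (p.e + p.f + p.g) := by
    unfold signT; rw [t2b_two_add_three, neg_one_pow_natAbs]
  have h3 : p.eps = (-1 : ℚ) ^ (p.a + p.b + p.e + p.f) := neg_one_pow_natAbs _
  rw [h1, h2, h3, ← zpow_add₀ (by norm_num), ← zpow_add₀ (by norm_num)]
  have : p.dInt + (p.e + p.f + p.g) + (p.a + p.b + p.e + p.f) = 2 * (2 * p.e + 2 * p.f + p.b - 2) + 1 := by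
    unfold dInt; ring
  rw [this]
  exact (odd_two_mul_add_one _).neg_one_zpow

/-! ### The forms through the functionals, sign-free -/

/-- `formQ + formQT = (−1)^d Π(p) · U1 p`. -/
theorem formQ_add_formQT (hd : 0 ≤ p.dInt) :
    formQ p.t1a p.t1b + formQT p.t2a p.t2b = (-1) ^ dExp p.t1a p.t1b * p.Pi * p.U1 := by
  have hq := link_formQ p.t1a p.t1b
  have hqt := link_formQT p.t2a p.t2b
  have s := sign_key p hd
  have e2 := eps_mul_eps p
  have d2 : ((-1 : ℚ)) ^ dExp p.t1a p.t1b * (-1 : ℚ) ^ dExp p.t1a p.t1b = 1 := by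
    rw [← pow_add, ← two_mul, pow_mul]; norm_num
  have hτ : signT p.t2b = -((-1 : ℚ) ^ dExp p.t1a p.t1b * p.eps) := by
    linear_combination ((-1 : ℚ) ^ dExp p.t1a p.t1b * p.eps) * s
      - (signT p.t2b * p.eps * p.eps) * d2 - signT p.t2b * e2
  have hP := Pi_ne_zero p
  unfold U1 vL vR nodeL nodeR
  rw [lam1_smul, altE1_smul, hqt, ← hq, hτ]
  field_simp

/-- `formP + formPT = −(−1)^d Π(p) · U0 p`. -/
theorem formP_add_formPT (hd : 0 ≤ p.dInt) :
    formP p.t1a p.t1b + formPT p.t2a p.t2b = -((-1) ^ dExp p.t1a p.t1b * p.Pi * p.U0) := by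
  have hp := link_formP p.t1a p.t1b
  have hpt := link_formPT p.t2a p.t2b
  have s := sign_key p hd
  have e2 := eps_mul_eps p
  have d2 : ((-1 : ℚ)) ^ dExp p.t1a p.t1b * (-1 : ℚ) ^ dExp p.t1a p.t1b = 1 := by
    rw [← pow_add, ← two_mul, pow_mul]; norm_num
  have hτ : signT p.t2b = -((-1 : ℚ) ^ dExp p.t1a p.t1b * p.eps) := by
    linear_combination ((-1 : ℚ) ^ dExp p.t1a p.t1b * p.eps) * s
      - (signT p.t2b * p.eps * p.eps) * d2 - signT p.t2b * e2
  have hP := Pi_ne_zero p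
  have hp' : formP p.t1a p.t1b = -((-1) ^ dExp p.t1a p.t1b * lam0 (dExp p.t1a p.t1b) (1 - a2star p.t1a)
      (dataR p.t1a p.t1b)) := by rw [hp]; ring
  unfold U0 vL vR nodeL nodeR
  rw [lam0_smul, altE0_smul, hpt, hp', hτ]
  field_simp
  ring

/-- **(bmiss) ⟺ the sign-free functional identities** `U1 p = 0 ∧ U0 p = 0` (for `d(p) ≥ 0`). -/
theorem bmiss_iff (hd : 0 ≤ p.dInt) : p.Bmiss ↔ p.U1 = 0 ∧ p.U0 = 0 := by
  have hK : ((-1 : ℚ)) ^ dExp p.t1a p.t1b * p.Pi ≠ 0 :=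
    mul_ne_zero (pow_ne_zero _ (by norm_num)) (Pi_ne_zero p)
  have h1 := formQ_add_formQT p hd
  have h0 := formP_add_formPT p hd
  unfold Bmiss
  constructor
  · rintro ⟨hq, hp⟩
    refine ⟨?_, ?_⟩
    · have : ((-1 : ℚ)) ^ dExp p.t1a p.t1b * p.Pi * p.U1 = 0 := by rw [← h1, hq]; ring
      exact (mul_eq_zero.1 this).resolve_left hK
    · have : ((-1 : ℚ)) ^ dExp p.t1a p.t1b * p.Pi * p.U0 = 0 := by linear_combination h0 - hp
      exact (mul_eq_zero.1 this).resolve_left hK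
  · rintro ⟨h1', h0'⟩
    rw [h1', mul_zero] at h1
    rw [h0', mul_zero, neg_zero] at h0
    constructor <;> linarith

/-! ### Values of the data: the two Barnes integrands -/

/-- `vL p` evaluates to `F_L(p;t) = num(t)/den(t)` off the poles (admissible parameters). -/
theorem vL_eval (h : Admissible p.t1a p.t1b) {t : ℚ} (ht : ∀ k ∈ Ico (p.t1a 3) (p.t1b 3), t + k ≠ 0) :
    p.vL.eval t = (num p.t1a p.t1b).eval t / (den p.t1a p.t1b).eval t := by
  unfold vL
  rw [PF.eval_smul, dataR_eval h ht]
  unfold R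
  have hP := Pi_ne_zero p
  simp only [Pt.Pi] at hP ⊢
  rw [← mul_div_assoc, inv_mul_cancel_left₀ hP]

/-- `vR p` evaluates to `F_R(p;u/2) = ε_p Π(p)⁻¹ R̂(â(p),b̂(p);u/2)` off the poles (admissible second-tale parameters). -/
theorem vR_eval (h : AdmissibleT p.t2a p.t2b) {u : ℚ} (hu : (denT p.t2a p.t2b).eval (u / 2) ≠ 0) :
    p.vR.eval u = p.eps * (p.Pi)⁻¹ * RT p.t2a p.t2b (u / 2) := by
  unfold vR
  rw [PF.eval_smul, dataRT_eval h hu]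

/-! ### The point P15 of the cell -/

/-- `P15 n = (15n+1, 9n+1, 13n+1, 11n+1, 26n+2)`. -/
def P15 (n : ℕ) : Pt := ⟨15 * n + 1, 9 * n + 1, 13 * n + 1, 11 * n + 1, 26 * n + 2⟩

/-- `a(P15 n) = aP15 n`. -/
theorem P15_t1a (n : ℕ) : (P15 n).t1a = TwoTaleP15.aP15 n := by
  ext i; fin_cases i <;> simp [P15, t1a, TwoTaleP15.aP15, TwoTaleP15.αv]

/-- `b(P15 n) = bP15 n`. -/
theorem P15_t1b (n : ℕ) : (P15 n).t1b = TwoTaleP15.bP15 n := by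
  ext i; fin_cases i <;> (simp [P15, t1b, TwoTaleP15.bP15]; try ring)

/-- `â(P15 n) = aT n`. -/
theorem P15_t2a (n : ℕ) : (P15 n).t2a = TwoTaleP15.aT n := by
  ext i; fin_cases i <;> (simp [P15, t2a, TwoTaleP15.aT]; try ring)

/-- `b̂(P15 n) = bT n`. -/
theorem P15_t2b (n : ℕ) : (P15 n).t2b = TwoTaleP15.bT n := by
  ext i; fin_cases i <;> (simp [P15, t2b, TwoTaleP15.bT]; try ring)

/-- `d(P15 n) = 16n − 1`. -/
theorem P15_dInt (n : ℕ) : (P15 n).dInt = 16 * n - 1 := by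
  unfold dInt P15; push_cast; ring

/-- **(bmiss) along P15 gives the cell's hypothesis `hP`** (the `p`-half; the `q`-half is the first conjunct). -/
theorem hP_of_Bmiss (h : ∀ n : ℕ, 1 ≤ n → (P15 n).Bmiss) :
    ∀ n : ℕ, 1 ≤ n → formP (TwoTaleP15.aP15 n) (TwoTaleP15.bP15 n) = -formPT (TwoTaleP15.aT n) (TwoTaleP15.bT n) := by
  intro n hn
  have := (h n hn).2
  rwa [P15_t1a, P15_t1b, P15_t2a, P15_t2b] at this

/-- Conversely phrased: the functional identities along P15 give `hP`. -/
theorem hP_of_U (h : ∀ n : ℕ, 1 ≤ n → (P15 n).U1 = 0 ∧ (P15 n).U0 = 0) :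
    ∀ n : ℕ, 1 ≤ n → formP (TwoTaleP15.aP15 n) (TwoTaleP15.bP15 n) = -formPT (TwoTaleP15.aT n) (TwoTaleP15.bT n) := by
  refine hP_of_Bmiss fun n hn => ((P15 n).bmiss_iff ?_).2 (h n hn)
  rw [P15_dInt]; omega

end Pt

end Summit.KontsevichZagierPeriods.Zeta5Search.TwoTaleOmega
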